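import Mathlib
import Summits.Ventures.FusionMHD.Models.SAlphaSecondStableS25A49875Core0
import HarnessLib

/-!
# STABLE-POINT core at `((5 / 2), 399/80)`, piece 8 (`[4, 6]`): kernel-decided Taylor-model leaves ⇒ `F_8 > 0` and `amplitudeResidual (5 / 2) (399/80) F_8 F_8″ ≤ 0` on the piece ⇒ `EnergyDominatesOn` for its amplitude phase

LADDER-GRIDFUSION rung F3 («F3.BALLOON-sα-S5o2-SECOND-EDGE-HALVING-2-A49875»: the second-edge bracket at s = 5/2 HALVED AGAIN from the stable side ([49/10, 203/40] → [49/10, 399/80]) (DIRECTOR RULING 67 (5) class / I4107 (2))); gridfusion-model-7 g10, 2026-08-28 (g8/g9 core lane).  Two `decide +kernel` calls (`OpModel.trig.pLeavesCheck`, scale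
`2^60`, Taylor degree 10, 16 leaves of half-width 1/16) and the lane's soundness theorem `OpSem.trig.pos_of_pLeavesCheck`
(Literature/Analysis/ValidatedNumerics/TaylorModelZeroCert); lit-4's `energyDominatesOn_of_amplitude` (BallooningSAlphaStableSide) turns the two
sign facts into energy domination by `amplitudePhase (5 / 2) (399/80) F_8 F_8′` on the piece.  MODELLED: `s–α` model; nothing about a device.
No `native_decide`.  Citations: Freidberg 2014 §12.6.2 (12.97) [Freidberg2014]; Makino–Berz 2003 Alg. 2 [MakinoBerz2003]; Hartman 2002 XI.6.2
[Hartman2002].  Everything here is [instance data].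
-/

open Literature.Analysis.ValidatedNumerics Literature.Analysis.ValidatedNumerics.PolyMP
open Literature.Analysis.ValidatedNumerics.NumericsMP Literature.Analysis.ValidatedNumerics.ExpPoly
open Literature.MathematicalPhysics.MHD.Ballooning
open Real Set

namespace Summit.Ventures.FusionMHD.Models

namespace SAlphaSecondStableS25A49875

/-- KERNEL CHECK (residual leaves of piece 8). [instance data] -/
theorem ss2549875_res8_ok : OpModel.trig.pLeavesCheck ss2549875Prm (2 ^ 60) (ss2549875Prog Za8 (Poly.deriv (Poly.deriv Za8))) [] ss2549875Leaves8 = true := by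
  decide +kernel

/-- KERNEL CHECK (positivity leaves of piece 8). [instance data] -/
theorem ss2549875_pos8_ok : OpModel.trig.pLeavesCheck ss2549875Prm (2 ^ 60) (ss2549875PosProg Za8) [] ss2549875Leaves8 = true := by
  decide +kernel

/-- The leaves tile `[4, 6]`. [instance data] -/
theorem ss2549875_tiles8 : tiles (4 : ℚ) (ss2549875Leaves8.map fun l => (l.e, l.k)) (6 : ℚ) = true := by
  decide +kernel

/-- **PIECE 8**: the phase of `F_8` dominates the `s–α` energy on `[4, 6]` at `(s, α) = ((5 / 2), 399/80)`. [instance data] -/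
theorem ss2549875_dominates8 :
    SAlpha.EnergyDominatesOn (5 / 2) (399 / 80) (SAlpha.amplitudePhase (5 / 2) (399 / 80) (Poly.eval Za8) (Poly.eval (Poly.deriv Za8)))
      (Icc (4 : ℝ) (6 : ℝ)) := by
  have h := ss2549875_dominates (lf := Za8) (x := 4) (y := 6) (by norm_num) ss2549875_tiles8 ss2549875_res8_ok ss2549875_pos8_ok
  norm_num at h
  exact h

end SAlphaSecondStableS25A49875

end Summit.Ventures.FusionMHD.Models
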